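import Literature.NumberTheory.ConnesConsani2021.TraceFunctionalPositivity
import Literature.NumberTheory.ConnesConsani2021.BestConstantLowerBound
import Literature.NumberTheory.ConnesConsani2021.ArchimedeanCorollary
import Literature.NumberTheory.ConnesConsani2021.ArchKernelTier2Final
import HarnessLib

/-!
# Connes–Consani 2021, Theorem 1 and eq. (4)/Theorem 6.11 — the archimedean Weil-positivity
# statements (`WeilArchPositivity_soninTrace`, `WeilArchPositivity_soninTrace_fine`) and Remark 6.12
# (`CC2021_rem_6_12`) FROM THE SINGLE §6 ANALYTIC INPUT (E-a)

A. Connes, C. Consani, *Weil positivity and trace formula, the archimedean place*, Selecta Math.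
(N.S.) 27 (2021), Paper No. 77 = arXiv:2006.13771 [bib: `ConnesConsani2021`]: Theorem 1 (Intro p. 4),
eq. (4) = Theorem 6.11 (= arXiv Thm. 44, §6.7 pp. 28–29, proof p. 29), Remark 6.12 (= arXiv Rem. 45,
p. 29).

LABEL (line 1): RH-FREE bookkeeping.  CC2021 Theorem 1 / eq. (4) are archimedean positivity statements
for test functions supported in `[2^{−1/2}, 2^{1/2}]` (NOT RH-detecting; cf. Yoshida's plain positivity
on the same support, `Literature.NumberTheory.LFunctions.weilPositivityOn_log_two_half`); Remark 6.12 is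
a LOWER bound on the optimal constant.  FRONTIER rung, zero summit credit.  WHAT THIS IS NOT: any claim
about RH — nothing here bears on the truth of RH.

**What is printed** (proof of Thm. 6.11, p. 29): "By Theorem 4.7 one has, for `f = g ∗ g*`,
`Tr(ϑ(f)𝐒) = W_∞(f) + E(f)` … `E(f) = E∘Q(k ∗ k*) = ⟨ξ|N_I(ξ)⟩ ≤ γ|⟨η₀|ξ⟩|² = (4γ/log 2)|ĝ(0)|²`, which
gives the required inequality" with `γ = 2aε′(1₊)` from Lemma 6.10 ("`⟨ξ|(1 − 𝐊_I)ξ⟩ + a|⟨η₀|ξ⟩|² ≥ 0`",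
`a ≃ 0.064`, `ε′(1₊) ≃ 22.9965`, `c = 4γ/log 2 < 17`) and Theorem 1 the case `ĝ(0) = 0` (Intro p. 4).

**What is PROVED here** (0 named facts introduced; pure assembly of tree theorems — the cell's route
`ConnesConsaniSemilocal` proves the same implication on the Summits side through its items K0–K3; this
module records it INSIDE `Literature/`, which cannot import the route, so that the three named facts leave
the unproved list by one-line corollaries the moment the Tier-2 kernel certificate of (E-a) lands):

* `weilArchPositivity_soninTrace_fine_of_section6Enclosures :
    CC2021_section6_enclosures → WeilArchPositivity_soninTrace_fine` — the p. 29 proof on tree theorems: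
  (H-TF) `CC2021_thm_4_7_weak_holds` (Theorem 4.7, weak trace form; seats t1/t4/gm-t13/gm-t15/t18),
  (H-ε) a `C²` archimedean density (`exists_contDiff_isArchDensity_summable_free`) with slope
  `e′ = G′(0) ∈ [22.9, 23.1]` (`densitySlope_of_section6Enclosures`, Lemma 5.4 `CC2021_lemma_5_4_holds` +
  the kernel enclosure of `ε′(1₊)`), (H-op) the certified window spectral bound with `a₀ ≤ 0.0635`
  (`windowSpectralBound_of_section6Enclosures`, i.e. the kernel-checked Route A-F certificate fed with
  (E-a)), (H-c) the arithmetic `8·0.0635·23.1/log 2 < 17` (`Real.log_two_gt_d9`), assembled by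
  `MainInequalityAssembly` through `weilArchPositivity_soninTrace_fine_of_thm_4_7_weak_of_opIneq`;
* `weilArchPositivity_soninTrace_of_section6Enclosures : CC2021_section6_enclosures →
    WeilArchPositivity_soninTrace` — Theorem 1, via `weilArchPositivity_soninTrace_of_thm_4_7_weak`
  (no constant needed: on `η₀^⊥` the window bound is plain positivity of `1 − 𝐊_I`);
* `section6Enclosures_consequences` — the conjunction with `CC2021_rem_6_12`
  (`BestConstantLowerBound.CC2021_rem_6_12_of_section6Enclosures`), and the same three over K3's ONE real
  inequality `∫_{[−log 2, log 2]}|τ_c − ϖ| ≤ 1/400` (`ArchKernelL1Frame.section6_enclosures_iff_L1`).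

No RH claim; net debt delta 0 (−3 by names once `CC2021_section6_enclosures_holds` is in the tree).
-/

noncomputable section

open MeasureTheory Set Complex
open scoped InnerProductSpace Real

namespace Literature.NumberTheory.ConnesConsani2021

open Literature.NumberTheory.LFunctions SpectralCert

/-- The printed arithmetic with the CERTIFIED constants: `8·a₀·e′/log 2 < 17` for `a₀ ≤ 0.0635`,
`e′ ≤ 23.1` (`8·0.0635·23.1 = 11.7348`, `log 2 > 0.6931471803`, quotient `< 16.94`; CC print
`c = 4γ/log 2 ≈ 16.99` at `a = 0.064`, `ε′(1₊) = 22.9965`). [cite: ConnesConsani2021, Thm. 6.11 §6.7 p. 28 ("`c = 4γ/log 2`"); Intro eq. (4) p. 4 ("`13 < c < 17`")] -/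
theorem certifiedConstants_mainInequality {a₀ e' : ℝ} (ha : a₀ ≤ 0.0635) (he : e' ≤ 23.1)
    (he0 : 0 ≤ e') : 8 * a₀ * e' / Real.log 2 < 17 := by
  have hlog : 0.6931471803 < Real.log 2 := Real.log_two_gt_d9
  have hpos : 0 < Real.log 2 := Real.log_pos one_lt_two
  rw [div_lt_iff₀ hpos]
  have h1 : 8 * a₀ * e' ≤ 8 * 0.0635 * 23.1 := by
    have := mul_le_mul ha he he0 (by norm_num)
    nlinarith
  nlinarith

/-- RH-FREE. **Connes–Consani 2021, eq. (4) / Theorem 6.11 (`WeilArchPositivity_soninTrace_fine`) FROM the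
§6 enclosures** (`CC2021_section6_enclosures` = (E-a) ∧ (E-b), (E-b) being the kernel theorem
`SlopeCert.epsSlope_enclosure_holds`): the printed proof of p. 29 assembled on tree theorems — Theorem 4.7
(weak trace form, `CC2021_thm_4_7_weak_holds`), a `C²` archimedean density with `G′(0) ∈ [22.9, 23.1]`,
the certified window spectral bound `⟨ξ|(1 − 𝐊_I)ξ⟩ + a₀|⟨η₀|ξ⟩|² ≥ 0` with `a₀ ≤ 0.0635`, and
`8a₀e′/log 2 < 17`. [cite: ConnesConsani2021, eq. (4) p. 4; Thm. 6.11 §6.7 pp. 28–29 (proof p. 29); Lemma 6.10 p. 28] -/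
theorem weilArchPositivity_soninTrace_fine_of_section6Enclosures (h : CC2021_section6_enclosures) :
    WeilArchPositivity_soninTrace_fine := by
  obtain ⟨G, hG, hGa, -⟩ := exists_contDiff_isArchDensity_summable_free
  obtain ⟨him, hlo, hhi⟩ := densitySlope_of_section6Enclosures CC2021_lemma_5_4_holds h G hG hGa
  obtain ⟨a₀, -, ha, hpos⟩ := windowSpectralBound_of_section6Enclosures h G hG hGa
  have hGe : deriv G 0 = (((deriv G 0).re : ℝ) : ℂ) := Complex.ext (by simp) (by simp [him])
  exact weilArchPositivity_soninTrace_fine_of_thm_4_7_weak_of_opIneq CC2021_thm_4_7_weak_holds hGa hG hGe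
    (by linarith) hpos (certifiedConstants_mainInequality ha hhi (by linarith))

/-- RH-FREE. **Connes–Consani 2021, Theorem 1 (`WeilArchPositivity_soninTrace`) FROM the §6 enclosures**
("Theorem 1 … Fourier transform vanishing at `i/2` and `0`", Intro p. 4; on `η₀^⊥` no constant is needed).
[cite: ConnesConsani2021, Thm. 1 (Intro p. 4); Thm. 6.11 §6.7 pp. 28–29] -/
theorem weilArchPositivity_soninTrace_of_section6Enclosures (h : CC2021_section6_enclosures) :
    WeilArchPositivity_soninTrace := by
  obtain ⟨G, hG, hGa, -⟩ := exists_contDiff_isArchDensity_summable_free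
  obtain ⟨him, hlo, -⟩ := densitySlope_of_section6Enclosures CC2021_lemma_5_4_holds h G hG hGa
  obtain ⟨a₀, -, -, hpos⟩ := windowSpectralBound_of_section6Enclosures h G hG hGa
  have hGe : deriv G 0 = (((deriv G 0).re : ℝ) : ℂ) := Complex.ext (by simp) (by simp [him])
  exact weilArchPositivity_soninTrace_of_thm_4_7_weak CC2021_thm_4_7_weak_holds hGa hG hGe (by linarith)
    hpos

/-- RH-FREE. Eq. (4) / Thm. 6.11 from the analytic input (E-a) ALONE, for any one `C²` archimedean
density `G` with `SpectralCert.AnalyticInputValid G` ((E-b) is the kernel theorem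
`SlopeCert.epsSlope_enclosure_holds`). [cite: ConnesConsani2021, eq. (4) p. 4; Thm. 6.11 §6.7 pp. 28–29] -/
theorem weilArchPositivity_soninTrace_fine_of_analyticInput {G : ℝ → ℂ} (hG : ContDiff ℝ 2 G)
    (hGa : IsArchDensity G) (hEa : AnalyticInputValid G) : WeilArchPositivity_soninTrace_fine := by
  obtain ⟨him, hlo, hhi⟩ :=
    densitySlope_of_lemma_5_4 CC2021_lemma_5_4_holds SlopeCert.epsSlope_enclosure_holds G hG hGa
  obtain ⟨a₀, -, ha, hpos⟩ := windowSpectralBound_of_L1 G hG hEa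
  have hGe : deriv G 0 = (((deriv G 0).re : ℝ) : ℂ) := Complex.ext (by simp) (by simp [him])
  exact weilArchPositivity_soninTrace_fine_of_thm_4_7_weak_of_opIneq CC2021_thm_4_7_weak_holds hGa hG hGe
    (by linarith) hpos (certifiedConstants_mainInequality ha hhi (by linarith))

/-- RH-FREE. Theorem 1 from the analytic input (E-a) alone. [cite: ConnesConsani2021, Thm. 1 (Intro p. 4)] -/
theorem weilArchPositivity_soninTrace_of_analyticInput {G : ℝ → ℂ} (hG : ContDiff ℝ 2 G)
    (hGa : IsArchDensity G) (hEa : AnalyticInputValid G) : WeilArchPositivity_soninTrace := by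
  obtain ⟨him, hlo, -⟩ :=
    densitySlope_of_lemma_5_4 CC2021_lemma_5_4_holds SlopeCert.epsSlope_enclosure_holds G hG hGa
  obtain ⟨a₀, -, -, hpos⟩ := windowSpectralBound_of_L1 G hG hEa
  have hGe : deriv G 0 = (((deriv G 0).re : ℝ) : ℂ) := Complex.ext (by simp) (by simp [him])
  exact weilArchPositivity_soninTrace_of_thm_4_7_weak CC2021_thm_4_7_weak_holds hGa hG hGe (by linarith)
    hpos

/-- RH-FREE. **The three §6-dependent named facts of the corpus from the ONE numerical fact**: eq. (4) /
Thm. 6.11, Theorem 1, and Remark 6.12 (`13 < c_best`). [cite: ConnesConsani2021, Thm. 1 and eq. (4) (Intro p. 4); Thm. 6.11, Remark 6.12 §6.7 pp. 28–29] -/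
theorem section6Enclosures_consequences (h : CC2021_section6_enclosures) :
    WeilArchPositivity_soninTrace_fine ∧ WeilArchPositivity_soninTrace ∧ CC2021_rem_6_12 :=
  ⟨weilArchPositivity_soninTrace_fine_of_section6Enclosures h,
    weilArchPositivity_soninTrace_of_section6Enclosures h, CC2021_rem_6_12_of_section6Enclosures h⟩

/-- RH-FREE. The same three consequences over K3's ONE real inequality
`∫_{[−log 2, log 2]}|τ_c − ϖ| ≤ ε₁ = 1/400` for THE prolate kernel `ϖ = prolateVarpi`
(`ArchKernelL1Frame.section6_enclosures_iff_L1`). [cite: ConnesConsani2021, §6.4 Fact 6.1 + Lemma 6.3 p. 24; Thm. 6.11 §6.7 pp. 28–29] -/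
theorem L1_prolateVarpi_consequences
    (h : ∫ v in Icc (-Real.log 2) (Real.log 2),
          ‖frameKernel (-(Real.log 2 / 2)) (Real.log 2 / 2) CertAF.N (fun n ↦ (CertAF.c n : ℝ)) v
              - ((prolateVarpi v : ℝ) : ℂ)‖
        ≤ ((CertAF.ε₁ : ℚ) : ℝ)) :
    WeilArchPositivity_soninTrace_fine ∧ WeilArchPositivity_soninTrace ∧ CC2021_rem_6_12 :=
  section6Enclosures_consequences (section6_enclosures_iff_L1.2 h)

/-! ## DISCHARGED: the Tier-2 kernel certificate of (E-a) has landed (`CC2021_section6_enclosures_holds`) -/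

/-- RH-FREE. **Connes–Consani 2021, eq. (4) / Theorem 6.11 — DISCHARGED**: the named fact
`WeilArchPositivity_soninTrace_fine` (`∃ c < 17, W_∞(g∗g*) ≥ Tr(ϑ(g)𝐒ϑ(g)*) − c|ĝ(0)|²` in the weak-trace
typing) is a tree theorem: Theorem 4.7 (weak form) + Prop. 5.5 + Lemma 6.3 + the kernel-certified §6 enclosures
(`CC2021_section6_enclosures_holds`, the cell's Tier-2 certificate of (E-a) at `ε₁ = 1/400`, and the kernel
enclosure of `ε′(1₊)`).  NOT RH-detecting (archimedean positivity on `[2^{−1/2}, 2^{1/2}]`; cf. Yoshida's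
`weilPositivityOn_log_two_half`). [cite: ConnesConsani2021, eq. (4) p. 4; Thm. 6.11 §6.7 pp. 28–29] -/
theorem WeilArchPositivity_soninTrace_fine_holds : WeilArchPositivity_soninTrace_fine :=
  weilArchPositivity_soninTrace_fine_of_section6Enclosures CC2021_section6_enclosures_holds

/-- RH-FREE. **Connes–Consani 2021, Theorem 1 — DISCHARGED** (`W_∞(g∗g*) ≥ Tr(ϑ(g)𝐒ϑ(g)*)` for `g` on
`[2^{−1/2}, 2^{1/2}]` with `ĝ(i/2) = ĝ(0) = 0`, weak-trace typing).  NOT RH-detecting.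
[cite: ConnesConsani2021, Thm. 1 (Intro p. 4)] -/
theorem WeilArchPositivity_soninTrace_holds : WeilArchPositivity_soninTrace :=
  weilArchPositivity_soninTrace_of_section6Enclosures CC2021_section6_enclosures_holds

/-- RH-FREE. **Connes–Consani 2021, Remark 6.12 (`13 < c_best`) — DISCHARGED** (the main inequality with
`c = 13` fails for some admissible `g`; `BestConstantLowerBound.lean`).
[cite: ConnesConsani2021, Remark 6.12 §6.7 p. 29 (arXiv Remark 45)] -/
theorem CC2021_rem_6_12_holds : CC2021_rem_6_12 :=
  CC2021_rem_6_12_of_section6Enclosures CC2021_section6_enclosures_holds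

/-- RH-FREE. **Connes–Consani 2021, Corollary 2 (Intro p. 4) — UNCONDITIONAL**: for `g` on
`[2^{−1/2}, 2^{1/2}]` with `ĝ(i/2) = 0`, some `c < 17` gives `c|ĝ(0)|² + Σ_{s∈S} ĝ(s)\overline{ĝ(s̄)} ≥
Tr(ϑ(g)𝐒ϑ(g)*)` (typed with the tree's symmetric zero sum `HasWeilZeroSide` and the weak trace; the
conditional form is `ArchimedeanCorollary.corollary_two_of_fine`, the zero side equals `W_∞(g∗g*)` by the
PROVED explicit formula).  A statement about sums over zeta zeros that holds unconditionally — NOT an RH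
claim. [cite: ConnesConsani2021, Cor. 2 (Intro p. 4)] -/
theorem corollary_two :
    ∃ c : ℝ, c < 17 ∧
      ∀ g : ℝ → ℂ, IsWeilTest g →
        tsupport g ⊆ Icc (-(Real.log 2 / 2)) (Real.log 2 / 2) →
        mulFourier g (I / 2) = 0 →
        ∀ Z : ℂ, HasWeilZeroSide (weilConv g (weilReflect g)) Z →
          ∀ (n : ℕ) (ξ : Fin n → Lp ℂ 2 (volume : Measure ℝ)),
            Orthonormal ℂ ξ → (∀ i, ξ i ∈ soninSpace 1 1) →
              ∑ i, (soninTraceForm (weilConv g (weilReflect g)) (ξ i : ℝ → ℂ)).re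
                  - c * ‖mulFourier g 0‖ ^ 2
                ≤ Z.re :=
  corollary_two_of_fine WeilArchPositivity_soninTrace_fine_holds

end Literature.NumberTheory.ConnesConsani2021

end
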